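import Literature.MathematicalPhysics.QuantumFieldTheory.Balaban1983to89.B15Prop1LocalChartFromThm1AtBaseCentralTower
import Literature.MathematicalPhysics.QuantumFieldTheory.Balaban1983to89.B15Prop1StateChartSU2

/-!
# `Balaban1983to89.B15Prop1SliceDatumCurvatureUniform` — [Balaban1985Variational] = «[15]», Sect. C (44)–(48) p. 285, (81)–(83) p. 290, Prop. 9 (190) p. 309; [Balaban1989LargeFieldII]
# = «[LF-II]», (1.12)–(1.13) p. 359; [Balaban1988Convergent] = «[III]», (2.10)–(2.12) p. 256; [Balaban1987RG1] (0.4) p. 253, (0.21) p. 256: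
# ONE CHART-CURVATURE CONSTANT FOR THE SLICE DATUM COORDINATES `Φ₀` OVER A COMPACT GUARDED FAMILY OF BACKGROUNDS — the letter (R2) `‖D²Φ₀(0)[p̂,p̂]‖ ≤ M₂·Σ_b‖p b‖²` of the
# (β)-split's multiplier row (M), in `Φ₀` currency, with `M₂` uniform per height

Honest framing: statement-level skeleton of published theorems with citation tags; proofs where landed; nothing here is a claim about the
Yang–Mills mass gap.  Cell `pub-ymgap`, HUMAN RULING D-0062 (Track A), seat `pub-ymgap-dag-n12-c` g26 (lane owner N12 = [B15], strategy s1); count-neutral; N12 NOT discharged;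
finite 𝕋⁴ at fixed ε; nothing continuum ∕ OS ∕ mass-gap ∕ Clay.

WHY (lane memo `N12-UNIFORMITY-SPEC.md` §8; bus OFFER 2026-08-29T12:56Z).  After the (β) split the (J0′) producer's multiplier row (M) is produced per base field (dag-n12-w6's
`…N12MultiplierLetterOfClass`, `m := 8(d−1)·δ·B₁·M₂`) from the gauge row (δ) and ONE displayed analytic letter (R2): for the complex slice datum coordinates
`Φ₀ X i = logCoordC (W_{j_i}(c_i)⋆ · Ū^{j_i}(expMulC X ↑U₀)(c_i))` ([15] (47)–(48)), `‖D²Φ₀(0)[p̂,p̂]‖ ≤ M₂·Σ_b‖p b‖²` — and `m` is chosen BEFORE the base field, so `M₂` must be UNIFORM over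
the minimisers of one height.  Print: [15] Sect. C (46) «|D²…| ≤ O(1)» and (81)–(83) p. 290 (the second-order term of the straightening map); [LF-II] (1.12)–(1.13) p. 359.  THIS FILE proves the
uniform bound over any COMPACT family of backgrounds that are (0.4)-guarded along the tower of every constrained bond: `Φ₀` is the restriction to the slice of the AMBIENT model
`G (V, A) X i = logCoordC (A_i · Ū^{j_i}(expMulC X V)(c_i))` at the parameter `a(U₀) = (↑U₀, (↑Ū^{j_i}(U₀)(c_i))⋆)` (the constraint `M˙(U₀) = W` puts the datum there), `G` is JOINTLY
ℂ-analytic in `((V, A), X)` at `(a(U₀), 0)` (the holomorphic iterate is analytic at tower-guarded fields — `B15AveragingHolomorphicLocalAnalytic`; the chart is entire; `logCoordC` is analytic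
at `A_i · Ū^{j_i}(↑U₀)(c_i) = u⋆u = 1`; no `star` inside the model — the adjoint datum is a PARAMETER), `a` is continuous on the family (the guarded averages are,
`B15Prop1LocalChartFromThm1AtBaseCentralTower.continuousAt_datum_of_guardOn`), so `a(T)` is compact and one constant bounds the second derivative (the `ℂ`-twin of NODE 00's
`MultiScaleFibreChartCurvatureUniform.exists_sq_bound_on_compact_of_contDiffAt_two`).  The record's compact family (the closed plaquette-small set around NODE 00's class) is supplied by
`Summits/…/BalabanUVNodesN12SliceDatumCurvatureOfClass`.

CONTENTS (theorems only; no `def`, no `instance`, no `sorry`).  §1 ★ `exists_sq_bound_on_compact_of_contDiffAt_two_complex`, `fderiv_fderiv_comp_clm_apply` (second derivative of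
`f ∘ L`); §2 `analyticAt_expMulC` (jointly), `expMulC_zero`, ★★ `analyticAt_sliceDatumModel`; §3 ★★★ `exists_uniform_sliceDatum_curvature_sq_bound` (`‖D²Φ₀(0)(v,v)‖ ≤ M₂‖v‖²` on a
compact guarded family), ★★★ `exists_uniform_sliceDatum_curvatureLetter` (dag-n12-w6's `hcurv` VERBATIM: `p̂ = cplxVec p ∈ S`, kernel hypothesis carried, `Σ_b‖p b‖²` on the right).
HONEST SCOPE: finite-dimensional calculus + compactness; `M₂` is an EXISTENCE constant per (torus, `𝔹`, `k`, family) — print's volume-uniform `O(1)` NOT claimed (U4 grade); nothing of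
Bałaban's estimates asserted; count-neutral; N12 NOT discharged; the YM mass gap (Clay) is NOT proved by any of this — R4 closes only the conditional finite-𝕋⁴ rung `BalabanLadder.UV`.
-/

noncomputable section

namespace Literature.MathematicalPhysics.QuantumFieldTheory.Balaban1983to89.B15Prop1SliceDatumCurvatureUniform

open Set Metric Filter
open scoped Topology BigOperators
open Literature.MathematicalPhysics.QuantumFieldTheory.Balaban1983to89.Node00 (SU coeField coeField_apply SmallBelow ConstrSet constrCard constrEnum star_coe_mul_coe_SU)
open B15AveragingHolomorphic (iterMh loopMh)
open B15AveragingHolomorphicLocalAnalytic (analyticAt_iterMh_apply_of_polydiscOn polydiscOn_of_guardOn)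
open B15AveragingHolomorphicTowerRegion (preimage_blockIter_saturated self_mem_bondsIn_towerRegion iterMh_coeField_apply_eq_of_guardOn_towerRegion)
open B15AveragingAnalytic (analyticAt_logCoordC)
open B15SU2ChartHolomorphic (genE expPointC expMulC logCoordC)
open B15Prop1StateChartSU2 (analyticAt_expPointC)
open B15Prop1DatumCoordinates (expPointC_zero)
open B15Prop1LocalChartFromThm1AtBaseCentralTower (continuousAt_datum_of_guardOn)
open B15Prop1ClassOpenAtRecord (isInducing_coeField)
open B15Prop1AnalyticExtClause (cplxVec norm_cplxVec)
open B15Prop1ChartCalculusSU2 (E3)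
open ExpMeanLog (expMeanLogSU deltaSU)
open BlockAveraging (Small Idx blockAvg)
open B10Eq42TorusConstraint (bondsIn)
open B14.Eq22Determines (blockIter)
open T4CubeChartGnomonic (SU2)
open T4Continuum B15DeterminingSets GaugeField
open scoped Matrix.Norms.L2Operator

/-! ## §1  Generic calculus over `ℂ` -/

section Generic

variable {E X V : Type*} [NormedAddCommGroup E] [NormedSpace ℂ E] [NormedAddCommGroup X] [NormedSpace ℂ X]
  [NormedAddCommGroup V] [NormedSpace ℂ V]

/-- ★ **A UNIFORM BOUND FOR A PARAMETER-DEPENDENT COMPLEX SECOND DERIVATIVE ON A COMPACT PARAMETER SET** [folklore] — the `ℂ`-twin of NODE 00's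
`MultiScaleFibreChartCurvatureUniform.exists_sq_bound_on_compact_of_contDiffAt_two`: if `(a, x) ↦ f a x` is `C²` over `ℂ` at `(a, 0)` for every `a` in a compact `S`, then
`‖D²(f a)(0)(w,w)‖ ≤ C‖w‖²` with ONE `C` for all `a ∈ S`. [cite: Balaban1985Variational, (81) p.290 (bookkeeping)] -/
theorem exists_sq_bound_on_compact_of_contDiffAt_two_complex [FiniteDimensional ℂ X] (f : E → X → V) {S : Set E} (hS : IsCompact S)
    (hf : ∀ a ∈ S, ContDiffAt ℂ 2 (Function.uncurry f) (a, 0)) :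
    ∃ C : ℝ, 0 ≤ C ∧ ∀ a ∈ S, ∀ w : X, ‖fderiv ℂ (fderiv ℂ (f a)) 0 w w‖ ≤ C * ‖w‖ ^ 2 := by
  haveI : ProperSpace X := FiniteDimensional.proper_rclike ℂ X
  have hcont : ∀ a ∈ S, ∀ u : X,
      ContinuousAt (fun p : E × X => ‖fderiv ℂ (fderiv ℂ (f p.1)) (0 : X) p.2 p.2‖) (a, u) := by
    intro a ha u
    have h1 : ContDiffAt ℂ 1 (fun p : E × X => fderiv ℂ (f p.1) p.2) (a, 0) := by
      have hu : ContDiffAt ℂ 2 (Function.uncurry fun (p : E × X) (y : X) => f p.1 y) ((a, (0 : X)), (0 : X)) := by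
        have hlin : ContDiff ℂ 2 (fun q : (E × X) × X => (q.1.1, q.2)) :=
          (contDiff_fst.comp contDiff_fst).prodMk contDiff_snd
        have heq : (Function.uncurry fun (p : E × X) (y : X) => f p.1 y) =
            Function.uncurry f ∘ fun q : (E × X) × X => (q.1.1, q.2) := rfl
        rw [heq]
        exact ContDiffAt.comp ((a, (0 : X)), (0 : X)) (hf a ha) hlin.contDiffAt
      exact hu.fderiv contDiffAt_snd (by norm_num)
    have h2 : ContDiffAt ℂ 0 (fun a' : E => fderiv ℂ (fun x : X => fderiv ℂ (f a') x) 0) a := by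
      have hu : ContDiffAt ℂ 1 (Function.uncurry fun (a' : E) (x : X) => fderiv ℂ (f a') x) (a, (0 : X)) := h1
      exact hu.fderiv contDiffAt_const (by norm_num)
    have h3 : ContinuousAt (fun p : E × X => fderiv ℂ (fun x : X => fderiv ℂ (f p.1) x) 0) (a, u) :=
      h2.continuousAt.comp_of_eq continuousAt_fst rfl
    have h4 : ContinuousAt (fun p : E × X => fderiv ℂ (fun x : X => fderiv ℂ (f p.1) x) 0 p.2 p.2) (a, u) :=
      (h3.clm_apply continuousAt_snd).clm_apply continuousAt_snd
    exact h4.norm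
  have hK : IsCompact (S ×ˢ closedBall (0 : X) 1) := hS.prod (isCompact_closedBall _ _)
  have hcontOn : ContinuousOn (fun p : E × X => ‖fderiv ℂ (fderiv ℂ (f p.1)) (0 : X) p.2 p.2‖) (S ×ˢ closedBall (0 : X) 1) :=
    fun p hp => (hcont p.1 hp.1 p.2).continuousWithinAt
  obtain ⟨C₀, hC₀⟩ := hK.exists_bound_of_continuousOn hcontOn
  refine ⟨max C₀ 0, le_max_right _ _, fun a ha w => ?_⟩
  by_cases hw : w = 0
  · subst hw; simp
  · have hnw : 0 < ‖w‖ := norm_pos_iff.2 hw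
    obtain ⟨u, hu⟩ : ∃ u : X, u = ((‖w‖⁻¹ : ℝ) : ℂ) • w := ⟨_, rfl⟩
    have hu1 : ‖u‖ ≤ 1 := by
      rw [hu, norm_smul, Complex.norm_real, Real.norm_eq_abs, abs_inv, abs_norm, inv_mul_cancel₀ hnw.ne']
    have hmem : (a, u) ∈ S ×ˢ closedBall (0 : X) 1 := ⟨ha, by simpa using hu1⟩
    have hb := hC₀ (a, u) hmem
    rw [Real.norm_eq_abs] at hb
    have hb' : ‖fderiv ℂ (fderiv ℂ (f a)) (0 : X) u u‖ ≤ max C₀ 0 := ((le_abs_self _).trans hb).trans (le_max_left _ _)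
    have hwu : ((‖w‖ : ℝ) : ℂ) • u = w := by
      rw [hu, smul_smul, ← Complex.ofReal_mul, mul_inv_cancel₀ hnw.ne', Complex.ofReal_one, one_smul]
    have hexp : fderiv ℂ (fderiv ℂ (f a)) (0 : X) (((‖w‖ : ℝ) : ℂ) • u) (((‖w‖ : ℝ) : ℂ) • u) =
        (((‖w‖ : ℝ) : ℂ) * ((‖w‖ : ℝ) : ℂ)) • fderiv ℂ (fderiv ℂ (f a)) (0 : X) u u := by
      rw [map_smul, map_smul, _root_.smul_apply, smul_smul]
    rw [← hwu, hexp, norm_smul, norm_mul, Complex.norm_real, Real.norm_eq_abs, abs_norm]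
    calc ‖w‖ * ‖w‖ * ‖fderiv ℂ (fderiv ℂ (f a)) 0 u u‖ ≤ ‖w‖ * ‖w‖ * max C₀ 0 := by gcongr
      _ = max C₀ 0 * ‖((‖w‖ : ℝ) : ℂ) • u‖ ^ 2 := by rw [hwu]; ring

end Generic

section Comp

variable {E F G : Type*} [NormedAddCommGroup E] [NormedSpace ℂ E] [NormedAddCommGroup F] [NormedSpace ℂ F]
  [NormedAddCommGroup G] [NormedSpace ℂ G]

/-- **SECOND DERIVATIVE OF A RESTRICTION**: for a continuous linear `L` and `f` of class `C²` at `0`, `D²(f ∘ L)(0)(v,w) = D²f(0)(Lv, Lw)` [folklore] (the slice datum coordinates are the ambient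
coordinate map restricted to the slice). [cite: Balaban1985Variational, (81) p.290 (bookkeeping)] -/
theorem fderiv_fderiv_comp_clm_apply (L : E →L[ℂ] F) {f : F → G} (hf : ContDiffAt ℂ 2 f 0) (v w : E) :
    fderiv ℂ (fderiv ℂ (f ∘ L)) 0 v w = fderiv ℂ (fderiv ℂ f) 0 (L v) (L w) := by
  have hd : ∀ᶠ y in 𝓝 (0 : F), DifferentiableAt ℂ f y := by
    have h := hf.eventually (by simp)
    exact h.mono fun y hy => hy.differentiableAt (by norm_num)
  have hL0 : L 0 = 0 := map_zero L
  have hdL : ∀ᶠ x in 𝓝 (0 : E), DifferentiableAt ℂ f (L x) := by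
    have hc : ContinuousAt L (0:E) := L.continuous.continuousAt
    rw [ContinuousAt, hL0] at hc
    exact hc.eventually hd
  have hev : fderiv ℂ (f ∘ L) =ᶠ[𝓝 0] (ContinuousLinearMap.precomp G L) ∘ fun x => fderiv ℂ f (L x) :=
    hdL.mono fun x hx => by
      rw [Function.comp_apply, ContinuousLinearMap.precomp_apply, fderiv_comp x hx L.differentiableAt, L.fderiv]
  have h2 : HasFDerivAt (fderiv ℂ f) (fderiv ℂ (fderiv ℂ f) 0) (L 0) := by
    rw [hL0]
    exact ((hf.fderiv_right (m := 1) le_rfl).differentiableAt one_ne_zero).hasFDerivAt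
  have h3 : HasFDerivAt (fun x => fderiv ℂ f (L x)) ((fderiv ℂ (fderiv ℂ f) 0).comp L) 0 := h2.comp 0 L.hasFDerivAt
  have h4 : HasFDerivAt ((ContinuousLinearMap.precomp G L) ∘ fun x => fderiv ℂ f (L x))
      ((ContinuousLinearMap.precomp G L).comp ((fderiv ℂ (fderiv ℂ f) 0).comp L)) 0 :=
    (ContinuousLinearMap.precomp G L).hasFDerivAt.comp 0 h3
  rw [hev.fderiv_eq, h4.fderiv]
  rfl

end Comp

/-! ## §2  The ambient slice-datum coordinate model and its joint analyticity in (background, datum adjoints, coordinates) -/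

section Model

variable {P : Params}

/-- **THE COMPLEXIFIED `expMul` IS JOINTLY ANALYTIC** in the coordinates and the field (bondwise `exp(Σ X_b^a E_a)·V_b`: the entire one-bond chart times a projection).
[cite: Balaban1985Variational, Sect. G p.305, Prop. 9 (190) p.309] -/
theorem analyticAt_expMulC {Y : Type*} [NormedAddCommGroup Y] [NormedSpace ℂ Y] {k : ℕ}
    {B : Y → VecField P k (EuclideanSpace ℂ (Fin 3))} {W : Y → PBond P k → Matrix (Fin 2) (Fin 2) ℂ} {y : Y}
    (hB : AnalyticAt ℂ B y) (hW : AnalyticAt ℂ W y) : AnalyticAt ℂ (fun y => expMulC (B y) (W y)) y := by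
  refine analyticAt_pi_iff.2 fun b => ?_
  show AnalyticAt ℂ (fun y => expPointC (B y b) * W y b) y
  have hBb : AnalyticAt ℂ (fun y => B y b) y :=
    ((ContinuousLinearMap.proj (R := ℂ) (φ := fun _ : PBond P k => EuclideanSpace ℂ (Fin 3)) b).analyticAt _).comp hB
  have hWb : AnalyticAt ℂ (fun y => W y b) y :=
    ((ContinuousLinearMap.proj (R := ℂ) (φ := fun _ : PBond P k => Matrix (Fin 2) (Fin 2) ℂ) b).analyticAt _).comp hW
  exact ((analyticAt_expPointC _).comp hBb).mul hWb

/-- `expMulC 0 V = V` (the chart is centred). [cite: Balaban1989LargeFieldII, (1.19) p.360 (bookkeeping)] -/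
theorem expMulC_zero {k : ℕ} (V : PBond P k → Matrix (Fin 2) (Fin 2) ℂ) : expMulC 0 V = V := by
  funext b
  simp [expMulC, expPointC_zero]

/-- ★★ **THE AMBIENT COORDINATE MODEL IS JOINTLY ℂ-ANALYTIC** in (background `V`, adjoint data `A`, coordinates `X`) at `((↑U, A), 0)`: for a determining set `𝔹` read below `k ≤ m + K`,
an `SU(2)` field `U` that is (0.4)-guarded along the tower of every constrained bond, and adjoint data `A` with `A_i · Ū^{j_i}(↑U)(c_i) = 1`, the map
`((V, A), X) ↦ (i ↦ logCoordC (A_i · Ū^{j_i}(expMulC X V)(c_i)))` is analytic (the holomorphic iterate is analytic at tower-guarded fields, `B15AveragingHolomorphicLocalAnalytic`; the chart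
is entire; `logCoordC` is analytic at `1`). [cite: Balaban1985Variational, Sect. C (47)–(48) p.285, Prop. 9 (190) p.309; Balaban1987RG1, (0.4) p.253, (0.21) p.256] -/
theorem analyticAt_sliceDatumModel (𝔹 : DetSet P) (k : ℕ) (hk : k ≤ P.m + P.K) {U : GaugeField P 0 SU2}
    (hg : ∀ i : Fin (constrCard 𝔹 k), ∀ j', j' < (((constrEnum 𝔹 k).symm i).1 : ℕ) → ∀ c' : PBond P (j' + 1),
      c' ∈ bondsIn (j' + 1) (blockIter (((constrEnum 𝔹 k).symm i).1 : ℕ) ⁻¹'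
        ({((constrEnum 𝔹 k).symm i).2.1.src, ((constrEnum 𝔹 k).symm i).2.1.tgt} : Set (Site P ((constrEnum 𝔹 k).symm i).1))) →
        Small expMeanLogSU (Averaging.iter (fun j => blockAvg (P := P) (j := j) expMeanLogSU) j' U) c')
    {A : Fin (constrCard 𝔹 k) → Matrix (Fin 2) (Fin 2) ℂ}
    (hA : ∀ i, A i * iterMh ((constrEnum 𝔹 k).symm i).1 (coeField U) ((constrEnum 𝔹 k).symm i).2.1 = 1) :
    AnalyticAt ℂ (Function.uncurry fun (a : (PBond P 0 → Matrix (Fin 2) (Fin 2) ℂ) × (Fin (constrCard 𝔹 k) → Matrix (Fin 2) (Fin 2) ℂ))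
        (X : VecField P 0 (EuclideanSpace ℂ (Fin 3))) =>
      fun i : Fin (constrCard 𝔹 k) => logCoordC (a.2 i * iterMh ((constrEnum 𝔹 k).symm i).1 (expMulC X a.1) ((constrEnum 𝔹 k).symm i).2.1))
      ((coeField U, A), 0) := by
  refine analyticAt_pi_iff.2 fun i => ?_
  set s := (constrEnum 𝔹 k).symm i with hs
  have hj : (s.1 : ℕ) ≤ P.m + P.K := (Nat.le_of_lt_succ s.1.2).trans hk
  -- the three coordinate projections of the parameter space
  set Ω := ((PBond P 0 → Matrix (Fin 2) (Fin 2) ℂ) × (Fin (constrCard 𝔹 k) → Matrix (Fin 2) (Fin 2) ℂ)) × VecField P 0 (EuclideanSpace ℂ (Fin 3))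
  have hV : AnalyticAt ℂ (fun q : Ω => q.1.1) ((coeField U, A), 0) := analyticAt_fst.comp analyticAt_fst
  have h12 : AnalyticAt ℂ (fun q : Ω => q.1.2) ((coeField U, A), 0) := analyticAt_snd.comp analyticAt_fst
  have hAi : AnalyticAt ℂ (fun q : Ω => q.1.2 i) ((coeField U, A), 0) :=
    ((ContinuousLinearMap.proj (R := ℂ) (φ := fun _ : Fin (constrCard 𝔹 k) => Matrix (Fin 2) (Fin 2) ℂ) i).analyticAt _).comp h12
  have hX : AnalyticAt ℂ (fun q : Ω => q.2) ((coeField U, A), 0) := analyticAt_snd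
  -- the chart, jointly
  have hE : AnalyticAt ℂ (fun q : Ω => expMulC q.2 q.1.1) ((coeField U, A), 0) := analyticAt_expMulC hX hV
  have hE0 : (fun q : Ω => expMulC q.2 q.1.1) ((coeField U, A), 0) = coeField U := by
    show expMulC 0 (coeField U) = coeField U
    exact expMulC_zero _
  -- the holomorphic iterate at the tower-guarded field
  have hpoly := polydiscOn_of_guardOn (N := 2) (s.1 : ℕ) hj (preimage_blockIter_saturated hj _) (hg i) (V₀ := coeField U) fun _ _ => rfl
  have hδ : deltaSU (Fin 2) ≤ 1 := by unfold deltaSU; exact (min_le_left _ _).trans (by norm_num)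
  have hIt : AnalyticAt ℂ (fun V : PBond P 0 → Matrix (Fin 2) (Fin 2) ℂ => iterMh (s.1 : ℕ) V s.2.1) (coeField U) :=
    analyticAt_iterMh_apply_of_polydiscOn (s.1 : ℕ) hj (preimage_blockIter_saturated hj _)
      (fun j' hj' c' hc' ι => (hpoly j' hj' c' hc' ι).trans_le hδ) s.2.1 (self_mem_bondsIn_towerRegion hj _)
  have hIt' : AnalyticAt ℂ (fun q : Ω => iterMh (s.1 : ℕ) (expMulC q.2 q.1.1) s.2.1) ((coeField U, A), 0) := hIt.comp_of_eq hE hE0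
  -- the product with the adjoint datum and the logarithmic coordinates at `1`
  have hM : AnalyticAt ℂ (fun q : Ω => q.1.2 i * iterMh (s.1 : ℕ) (expMulC q.2 q.1.1) s.2.1) ((coeField U, A), 0) := hAi.mul hIt'
  have hM0 : (fun q : Ω => q.1.2 i * iterMh (s.1 : ℕ) (expMulC q.2 q.1.1) s.2.1) ((coeField U, A), 0) = 1 := by
    show A i * iterMh (s.1 : ℕ) (expMulC 0 (coeField U)) s.2.1 = 1
    rw [expMulC_zero]
    exact hA i
  have hL : AnalyticAt ℂ logCoordC (1 : Matrix (Fin 2) (Fin 2) ℂ) := analyticAt_logCoordC (by rw [sub_self, norm_zero]; exact one_pos)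
  exact hL.comp_of_eq hM hM0

end Model

/-! ## §3  One chart-curvature constant per compact guarded family of backgrounds: the letter (R2) -/

section Uniform

variable {P : Params}

/-- ★★★ **ONE SLICE-DATUM CURVATURE CONSTANT FOR A COMPACT GUARDED FAMILY OF BACKGROUNDS.**  Objects: a determining set `𝔹` read below `k ≤ m + K`; a COMPACT set `T` of `SU(2)`
configurations each of which is (0.4)-guarded along the tower of every constrained bond of `𝔹` (at the record: the closed plaquette-small set around NODE 00's class, see
`Summits/…/BalabanUVNodesN12SliceDatumCurvatureOfClass`).  CONCLUSION: there is `M₂ ≥ 0` such that for EVERY `U₀ ∈ T`, EVERY multi-scale datum `W` on whose fibre `U₀` lies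
(`M˙(U₀) = W` on `𝔹`), EVERY complex slice `S` and the slice datum coordinates `Φ₀ : S → (𝔹 → ℂ³)` by their formula, `‖D²Φ₀(0)(v,v)‖ ≤ M₂·‖v‖²` for all `v ∈ S`.  Proof: `Φ₀` is
§2's jointly analytic model at the parameter `a(U₀) = (↑U₀, (↑Ū^{j_i}(U₀)(c_i))⋆)` restricted to `S` (`fderiv_fderiv_comp_clm_apply`); `a` is continuous on `T` (the averages are, where
guarded: `B15Prop1LocalChartFromThm1AtBaseCentralTower.continuousAt_datum_of_guardOn`), so `a(T)` is compact and §1 gives one constant.  LOCATED: `M₂` depends on `(P, 𝔹, k, T)` — a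
per-height EXISTENCE constant (U4 grade), NOT print's volume-uniform `O(1)` of [15] (46).
[cite: Balaban1985Variational, Sect. C (44)–(48) p.285, (81)–(83) p.290, Prop. 9 (190) p.309; Balaban1989LargeFieldII, (1.12)–(1.13) p.359; Balaban1988Convergent, (2.10)–(2.12) p.256; Balaban1987RG1, (0.4) p.253] -/
theorem exists_uniform_sliceDatum_curvature_sq_bound (𝔹 : DetSet P) (k : ℕ) (hk : k ≤ P.m + P.K)
    {T : Set (GaugeField P 0 SU2)} (hT : IsCompact T)
    (hgT : ∀ U ∈ T, ∀ i : Fin (constrCard 𝔹 k), ∀ j', j' < (((constrEnum 𝔹 k).symm i).1 : ℕ) → ∀ c' : PBond P (j' + 1),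
      c' ∈ bondsIn (j' + 1) (blockIter (((constrEnum 𝔹 k).symm i).1 : ℕ) ⁻¹'
        ({((constrEnum 𝔹 k).symm i).2.1.src, ((constrEnum 𝔹 k).symm i).2.1.tgt} : Set (Site P ((constrEnum 𝔹 k).symm i).1))) →
        Small expMeanLogSU (Averaging.iter (fun j => blockAvg (P := P) (j := j) expMeanLogSU) j' U) c') :
    ∃ M₂ : ℝ, 0 ≤ M₂ ∧ ∀ U₀ ∈ T, ∀ W : MSField P SU2, AgreeOn 𝔹 (avgFamily (fun j => blockAvg (P := P) (j := j) expMeanLogSU) U₀) W →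
      ∀ (S : Submodule ℂ (VecField P 0 (EuclideanSpace ℂ (Fin 3)))) (Φ₀ : S → Fin (constrCard 𝔹 k) → EuclideanSpace ℂ (Fin 3)),
        (∀ (X : S) i, Φ₀ X i = logCoordC (star ((W ((constrEnum 𝔹 k).symm i).1 ((constrEnum 𝔹 k).symm i).2.1 : SU2) : Matrix (Fin 2) (Fin 2) ℂ) *
          iterMh ((constrEnum 𝔹 k).symm i).1 (expMulC (X : VecField P 0 (EuclideanSpace ℂ (Fin 3))) (coeField U₀)) ((constrEnum 𝔹 k).symm i).2.1)) →
        ∀ v : S, ‖fderiv ℂ (fderiv ℂ Φ₀) 0 v v‖ ≤ M₂ * ‖v‖ ^ 2 := by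
  -- the parameter map `a(U) = (↑U, (↑Ū^{j_i}(U)(c_i))⋆)` and its compact image
  let a : GaugeField P 0 SU2 → (PBond P 0 → Matrix (Fin 2) (Fin 2) ℂ) × (Fin (constrCard 𝔹 k) → Matrix (Fin 2) (Fin 2) ℂ) := fun U =>
    (coeField U, fun i => star (((avgFamily (fun j => blockAvg (P := P) (j := j) expMeanLogSU) U ((constrEnum 𝔹 k).symm i).1
      ((constrEnum 𝔹 k).symm i).2.1 : SU2) : Matrix (Fin 2) (Fin 2) ℂ)))
  have hcoe : Continuous (coeField : GaugeField P 0 SU2 → PBond P 0 → Matrix (Fin 2) (Fin 2) ℂ) := isInducing_coeField.continuous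
  have ha : ContinuousOn a T := fun U hU => by
    refine ContinuousAt.continuousWithinAt (ContinuousAt.prodMk hcoe.continuousAt ?_)
    exact (continuous_star.continuousAt).comp (continuousAt_datum_of_guardOn 𝔹 k hk (hgT U hU))
  have hS : IsCompact (a '' T) := hT.image_of_continuousOn ha
  -- the model is `C²` at every parameter of the image
  let G : (PBond P 0 → Matrix (Fin 2) (Fin 2) ℂ) × (Fin (constrCard 𝔹 k) → Matrix (Fin 2) (Fin 2) ℂ) → VecField P 0 (EuclideanSpace ℂ (Fin 3)) →
      Fin (constrCard 𝔹 k) → EuclideanSpace ℂ (Fin 3) := fun p X i =>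
    logCoordC (p.2 i * iterMh ((constrEnum 𝔹 k).symm i).1 (expMulC X p.1) ((constrEnum 𝔹 k).symm i).2.1)
  have hA : ∀ U ∈ T, ∀ i, (a U).2 i * iterMh ((constrEnum 𝔹 k).symm i).1 (coeField U) ((constrEnum 𝔹 k).symm i).2.1 = 1 := fun U hU i => by
    have hj : ((((constrEnum 𝔹 k).symm i).1 : ℕ)) ≤ P.m + P.K := (Nat.le_of_lt_succ ((constrEnum 𝔹 k).symm i).1.2).trans hk
    show star (((avgFamily (fun j => blockAvg (P := P) (j := j) expMeanLogSU) U ((constrEnum 𝔹 k).symm i).1 ((constrEnum 𝔹 k).symm i).2.1 : SU2) :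
        Matrix (Fin 2) (Fin 2) ℂ)) * iterMh ((constrEnum 𝔹 k).symm i).1 (coeField U) ((constrEnum 𝔹 k).symm i).2.1 = 1
    rw [iterMh_coeField_apply_eq_of_guardOn_towerRegion hj _ (hgT U hU i)]
    exact star_coe_mul_coe_SU _
  have hG : ∀ p ∈ a '' T, ContDiffAt ℂ 2 (Function.uncurry G) (p, 0) := by
    rintro _ ⟨U, hU, rfl⟩
    exact (analyticAt_sliceDatumModel 𝔹 k hk (hgT U hU) (hA U hU)).contDiffAt
  obtain ⟨C, hC, hbound⟩ := exists_sq_bound_on_compact_of_contDiffAt_two_complex G hS hG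
  refine ⟨C, hC, fun U₀ hU₀ W hW S Φ₀ hΦ₀ v => ?_⟩
  -- `Φ₀` is the model at `a U₀` restricted to the slice
  have hfun : Φ₀ = G (a U₀) ∘ S.subtypeL := by
    funext X; funext i
    rw [hΦ₀ X i, ← hW _ _ ((constrEnum 𝔹 k).symm i).2.2]
    rfl
  have h2 : ContDiffAt ℂ 2 (G (a U₀)) 0 := by
    have h := hG _ ⟨U₀, hU₀, rfl⟩
    exact h.comp 0 (contDiffAt_const.prodMk contDiffAt_id)
  rw [hfun, fderiv_fderiv_comp_clm_apply S.subtypeL h2 v v]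
  have hn : ‖v‖ = ‖(S.subtypeL v : VecField P 0 (EuclideanSpace ℂ (Fin 3)))‖ := rfl
  rw [hn]
  exact hbound (a U₀) ⟨U₀, hU₀, rfl⟩ (S.subtypeL v)

/-- ★★★ **THE LETTER (R2) OF THE (M)-ROW PRODUCER, INHABITED ON A COMPACT GUARDED FAMILY** — dag-n12-w6's displayed `hcurv` VERBATIM (`p̂ = cplxVec p ∈ S`, kernel hypothesis carried and
unused): `‖D²Φ₀(0)[p̂,p̂]‖ ≤ M₂·Σ_b‖p b‖²` with the constant of `exists_uniform_sliceDatum_curvature_sq_bound` (`‖p̂‖² = ‖p‖² ≤ Σ_b‖p b‖²`, sup norm against `ℓ²`).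
[cite: Balaban1985Variational, Sect. C (44)–(48) p.285, (81)–(83) p.290; Balaban1989LargeFieldII, (1.12)–(1.13) p.359; Balaban1988Convergent, (2.10)–(2.12) p.256] -/
theorem exists_uniform_sliceDatum_curvatureLetter (𝔹 : DetSet P) (k : ℕ) (hk : k ≤ P.m + P.K)
    {T : Set (GaugeField P 0 SU2)} (hT : IsCompact T)
    (hgT : ∀ U ∈ T, ∀ i : Fin (constrCard 𝔹 k), ∀ j', j' < (((constrEnum 𝔹 k).symm i).1 : ℕ) → ∀ c' : PBond P (j' + 1),
      c' ∈ bondsIn (j' + 1) (blockIter (((constrEnum 𝔹 k).symm i).1 : ℕ) ⁻¹'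
        ({((constrEnum 𝔹 k).symm i).2.1.src, ((constrEnum 𝔹 k).symm i).2.1.tgt} : Set (Site P ((constrEnum 𝔹 k).symm i).1))) →
        Small expMeanLogSU (Averaging.iter (fun j => blockAvg (P := P) (j := j) expMeanLogSU) j' U) c') :
    ∃ M₂ : ℝ, 0 ≤ M₂ ∧ ∀ U₀ ∈ T, ∀ W : MSField P SU2, AgreeOn 𝔹 (avgFamily (fun j => blockAvg (P := P) (j := j) expMeanLogSU) U₀) W →
      ∀ (S : Submodule ℂ (VecField P 0 (EuclideanSpace ℂ (Fin 3)))) (Φ₀ : S → Fin (constrCard 𝔹 k) → EuclideanSpace ℂ (Fin 3)),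
        (∀ (X : S) i, Φ₀ X i = logCoordC (star ((W ((constrEnum 𝔹 k).symm i).1 ((constrEnum 𝔹 k).symm i).2.1 : SU2) : Matrix (Fin 2) (Fin 2) ℂ) *
          iterMh ((constrEnum 𝔹 k).symm i).1 (expMulC (X : VecField P 0 (EuclideanSpace ℂ (Fin 3))) (coeField U₀)) ((constrEnum 𝔹 k).symm i).2.1)) →
        ∀ (p : VecField P 0 E3) (hp : cplxVec p ∈ S), fderiv ℂ Φ₀ 0 ⟨cplxVec p, hp⟩ = 0 →
          ‖fderiv ℂ (fderiv ℂ Φ₀) 0 ⟨cplxVec p, hp⟩ ⟨cplxVec p, hp⟩‖ ≤ M₂ * ∑ b : PBond P 0, ‖p b‖ ^ 2 := by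
  obtain ⟨M₂, hM₂, h⟩ := exists_uniform_sliceDatum_curvature_sq_bound 𝔹 k hk hT hgT
  refine ⟨M₂, hM₂, fun U₀ hU₀ W hW S Φ₀ hΦ₀ p hp _ => (h U₀ hU₀ W hW S Φ₀ hΦ₀ ⟨cplxVec p, hp⟩).trans ?_⟩
  refine mul_le_mul_of_nonneg_left ?_ hM₂
  -- `‖p̂‖² = ‖p‖² ≤ Σ_b ‖p b‖²` (sup norm against `ℓ²`)
  have hn : ‖(⟨cplxVec p, hp⟩ : S)‖ = ‖p‖ := by rw [Submodule.coe_norm]; exact norm_cplxVec p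
  rw [hn]
  have hle : ‖p‖ ≤ Real.sqrt (∑ b, ‖p b‖ ^ 2) :=
    (pi_norm_le_iff_of_nonneg (Real.sqrt_nonneg _)).2 fun b =>
      Real.le_sqrt_of_sq_le (Finset.single_le_sum (f := fun b => ‖p b‖ ^ 2) (fun b _ => sq_nonneg _) (Finset.mem_univ b))
  calc ‖p‖ ^ 2 ≤ Real.sqrt (∑ b, ‖p b‖ ^ 2) ^ 2 := pow_le_pow_left₀ (norm_nonneg _) hle 2
    _ = ∑ b, ‖p b‖ ^ 2 := Real.sq_sqrt (Finset.sum_nonneg fun b _ => sq_nonneg _)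

end Uniform

end Literature.MathematicalPhysics.QuantumFieldTheory.Balaban1983to89.B15Prop1SliceDatumCurvatureUniform

end
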